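import Literature.Geometry.Lorentzian.KerrBoyerLindquistLeaf
import Literature.Geometry.Lorentzian.KerrBoyerLindquistSliceNormal
import Literature.Geometry.Lorentzian.KerrAxialKillingField
import HarnessLib

/-!
# The Boyer–Lindquist slice of Kerr as a map from quasi-isotropic Cartesian coordinates, V:
# the future unit normal

Continuing `KerrBoyerLindquistLeaf.lean` and `KerrBoyerLindquistSliceNormal.lean`: the future unit
normal of the Boyer–Lindquist leaf `Kerr.BL.leaf M a b ρ₁` in the ingoing Kerr–Schild chart is

  `n(y) = α(y)⁻¹ (∂_{t*} + ω(y) J(L(y)))`,  `J(x) = x₁∂₂ − x₂∂₁` (the axial field `∂_φ`),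

with the Boyer–Lindquist lapse `α = √(ΔΣ/A)` and frame-dragging velocity `ω = 2MRa/A` read at
`(R(‖y‖), μ = y₃/‖y‖)` (`Kerr.BL.lapseE`, `omegaE`, `normalRep`). Off the axis this is the
push-forward `J_u n_u` of the coordinate normal `Kerr.Ingoing.blNormal` by the Jacobian of the
ingoing chart (`normalRep_eq`), so `g(n, dL v) = 0` and `g(n, n) = −1` there (`kerrBilin_jac` and the
coordinate identities of `…SliceNormal.lean`); both identities extend over the axis by continuity
(`Kerr.eqOn_slice_of_offAxis`). With `n⁰ = α⁻¹ > 0` and `g(−g♯dt*, n) = −n⁰ < 0` this gives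
**`isFutureUnitNormal_normal`**: `n` is the future unit normal of the leaf for the Kerr time
orientation — the fourth clause of an exact Kerr end (`InitialDataSet.IsExactKerrEndAlong`).

References: Bardeen–Press–Teukolsky, ApJ 178 (1972) 347, (2.3)–(2.5); Brandt–Seidel, Phys. Rev.
D 54 (1996) 1403, §II; Wald 1984, §10.2; O'Neill 1983, Ch. 4, p. 106.
-/

noncomputable section

open Bundle TopologicalSpace Set Module Real Filter
open scoped InnerProductSpace Topology ContDiff Manifold

namespace Literature.Geometry.Lorentzian

namespace Kerr.BL

open Kerr.Ingoing

variable {M a b ρ₁ : ℝ}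

/-! ### Profile functions on the quasi-isotropic space -/

/-- `Σ(y) = R(‖y‖)² + a² y₃²/‖y‖²` (`= R² + a² cos²θ`). [cite: BrandtSeidel1996, §II] -/
def sigmaE (M a : ℝ) (y : E3) : ℝ :=
  qiRadius M a ‖y‖ ^ 2 + a ^ 2 * (y 2 / ‖y‖) ^ 2

/-- `A(y) = (R² + a²) Σ + 2MRa² (1 − μ²)` read at `(R(‖y‖), μ = y₃/‖y‖)`. [cite: BrandtSeidel1996, §II] -/
def bigA (M a : ℝ) (y : E3) : ℝ :=
  (qiRadius M a ‖y‖ ^ 2 + a ^ 2) * sigmaE M a y +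
    2 * M * qiRadius M a ‖y‖ * a ^ 2 * (1 - (y 2 / ‖y‖) ^ 2)

/-- The frame-dragging velocity `ω(y) = 2MRa/A`. Bardeen–Press–Teukolsky 1972, (2.3).
[cite: BrandtSeidel1996, §II] -/
def omegaE (M a : ℝ) (y : E3) : ℝ :=
  2 * M * qiRadius M a ‖y‖ * a / bigA M a y

/-- The Boyer–Lindquist lapse `α(y) = √(Δ(R) Σ/A)`. Bardeen–Press–Teukolsky 1972, (2.3).
[cite: BrandtSeidel1996, §II] -/
def lapseE (M a : ℝ) (y : E3) : ℝ :=
  √(Ingoing.delta M a (qiRadius M a ‖y‖) * sigmaE M a y / bigA M a y)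

section Bridge

variable {u : E4} {y : E3}

/-- Bridge to the coordinate functions: `Σ`. [cite: BrandtSeidel1996, §II] -/
theorem sigma_eq_sigmaE (h1 : u 1 = qiRadius M a ‖y‖) (h2 : u 2 = y 2 / ‖y‖) :
    sigma a u = sigmaE M a y := by
  simp only [sigma, sigmaE, h1, h2]

/-- Bridge to the coordinate functions: `A`. [cite: BrandtSeidel1996, §II] -/
theorem blA_eq_bigA (h1 : u 1 = qiRadius M a ‖y‖) (h2 : u 2 = y 2 / ‖y‖) :
    blA M a u = bigA M a y := by
  simp only [blA, bigA, sinSq, sigma_eq_sigmaE h1 h2, h1, h2]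

/-- Bridge to the coordinate functions: `ω`. [cite: BrandtSeidel1996, §II] -/
theorem blOmega_eq_omegaE (h1 : u 1 = qiRadius M a ‖y‖) (h2 : u 2 = y 2 / ‖y‖) :
    blOmega M a u = omegaE M a y := by
  simp only [blOmega, omegaE, blA_eq_bigA h1 h2, h1]

/-- Bridge to the coordinate functions: `α`. [cite: BrandtSeidel1996, §II] -/
theorem blLapse_eq_lapseE (h1 : u 1 = qiRadius M a ‖y‖) (h2 : u 2 = y 2 / ‖y‖) :
    blLapse M a u = lapseE M a y := by
  simp only [blLapse, lapseE, blA_eq_bigA h1 h2, sigma_eq_sigmaE h1 h2, h1]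

end Bridge

/-! ### Positivity beyond the threshold -/

/-- `(y₃/‖y‖)² ≤ 1`. [folklore] -/
theorem sq_div_norm_le_one (y : E3) : (y 2 / ‖y‖) ^ 2 ≤ 1 := by
  by_cases hy : ‖y‖ = 0
  · rw [hy, div_zero]; norm_num
  have h := EuclideanSpace.real_norm_sq_eq y
  rw [Fin.sum_univ_three] at h
  rw [div_pow, div_le_one (by positivity)]
  nlinarith [sq_nonneg (y 0), sq_nonneg (y 1)]

/-- `Σ > 0` beyond the threshold (`0 ≤ M`). [cite: BrandtSeidel1996, §II] -/
theorem sigmaE_pos (hM : 0 ≤ M) {y : E3} (hy : rhoH M a < ‖y‖) : 0 < sigmaE M a y := by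
  have hR := qiRadius_pos_of_rhoH_lt hM hy
  unfold sigmaE
  positivity

/-- `A > 0` beyond the threshold (`0 ≤ M`). [cite: BrandtSeidel1996, §II] -/
theorem bigA_pos (hM : 0 ≤ M) {y : E3} (hy : rhoH M a < ‖y‖) : 0 < bigA M a y := by
  have hR := qiRadius_pos_of_rhoH_lt hM hy
  have hS := sigmaE_pos hM hy (a := a)
  have hμ : 0 ≤ 1 - (y 2 / ‖y‖) ^ 2 := sub_nonneg.2 (sq_div_norm_le_one y)
  unfold bigA
  have h1 : 0 < (qiRadius M a ‖y‖ ^ 2 + a ^ 2) * sigmaE M a y := by positivity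
  have h2 : 0 ≤ 2 * M * qiRadius M a ‖y‖ * a ^ 2 * (1 - (y 2 / ‖y‖) ^ 2) := by positivity
  linarith

/-- `Δ(R(‖y‖)) > 0` beyond the threshold. [cite: BrandtSeidel1996, §II] -/
theorem delta_qiRadius_pos {y : E3} (hy : rhoH M a < ‖y‖) :
    0 < Ingoing.delta M a (qiRadius M a ‖y‖) :=
  delta_pos_of_rH_lt (qiRadius_gt_rH hy)

/-- `α² = ΔΣ/A > 0` beyond the threshold (`0 ≤ M`). [cite: BrandtSeidel1996, §II] -/
theorem lapseSq_pos (hM : 0 ≤ M) {y : E3} (hy : rhoH M a < ‖y‖) :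
    0 < Ingoing.delta M a (qiRadius M a ‖y‖) * sigmaE M a y / bigA M a y :=
  div_pos (mul_pos (delta_qiRadius_pos hy) (sigmaE_pos hM hy)) (bigA_pos hM hy)

/-- `α > 0` beyond the threshold (`0 ≤ M`). [cite: BrandtSeidel1996, §II] -/
theorem lapseE_pos (hM : 0 ≤ M) {y : E3} (hy : rhoH M a < ‖y‖) : 0 < lapseE M a y :=
  Real.sqrt_pos.2 (lapseSq_pos hM hy)

/-! ### Smoothness of the profile functions -/

section Smooth

variable {n : WithTop ℕ∞}

/-- `y ↦ y₃/‖y‖` is smooth off the origin. [folklore] -/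
theorem contDiffAt_div_norm {y : E3} (hy : y ≠ 0) : ContDiffAt ℝ n (fun y : E3 ↦ y 2 / ‖y‖) y :=
  ((EuclideanSpace.proj (𝕜 := ℝ) (2 : Fin 3)).contDiff.contDiffAt).div (contDiffAt_norm ℝ hy)
    (norm_ne_zero_iff.2 hy)

/-- `Σ` is smooth off the origin. [cite: BrandtSeidel1996, §II] -/
theorem contDiffAt_sigmaE {y : E3} (hy : y ≠ 0) : ContDiffAt ℝ n (sigmaE M a) y := by
  unfold sigmaE
  exact ((contDiffAt_qiRadius_norm M a hy).pow 2).add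
    (contDiffAt_const.mul ((contDiffAt_div_norm hy).pow 2))

/-- `A` is smooth off the origin. [cite: BrandtSeidel1996, §II] -/
theorem contDiffAt_bigA {y : E3} (hy : y ≠ 0) : ContDiffAt ℝ n (bigA M a) y := by
  unfold bigA
  exact ((((contDiffAt_qiRadius_norm M a hy).pow 2).add contDiffAt_const).mul
    (contDiffAt_sigmaE hy)).add
    ((((contDiffAt_const.mul (contDiffAt_qiRadius_norm M a hy)).mul contDiffAt_const)).mul
      (contDiffAt_const.sub ((contDiffAt_div_norm hy).pow 2)))

/-- `ω` is smooth beyond the threshold (`0 ≤ M`). [cite: BrandtSeidel1996, §II] -/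
theorem contDiffAt_omegaE (hM : 0 ≤ M) {y : E3} (hy : rhoH M a < ‖y‖) :
    ContDiffAt ℝ n (omegaE M a) y := by
  have hy0 : y ≠ 0 := by
    intro h0; rw [h0, norm_zero] at hy; exact absurd hy (not_lt.2 (rhoH_nonneg M a))
  unfold omegaE
  exact (((contDiffAt_const.mul (contDiffAt_qiRadius_norm M a hy0)).mul contDiffAt_const)).div
    (contDiffAt_bigA hy0) (bigA_pos hM hy).ne'

/-- `α` is smooth beyond the threshold (`0 ≤ M`). [cite: BrandtSeidel1996, §II] -/
theorem contDiffAt_lapseE (hM : 0 ≤ M) {y : E3} (hy : rhoH M a < ‖y‖) :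
    ContDiffAt ℝ n (lapseE M a) y := by
  have hy0 : y ≠ 0 := by
    intro h0; rw [h0, norm_zero] at hy; exact absurd hy (not_lt.2 (rhoH_nonneg M a))
  have hΔ : ContDiffAt ℝ n (fun y : E3 ↦ Ingoing.delta M a (qiRadius M a ‖y‖)) y := by
    simp only [Ingoing.delta]
    exact (((contDiffAt_qiRadius_norm M a hy0).pow 2).sub
      ((contDiffAt_const.mul (contDiffAt_qiRadius_norm M a hy0)))).add contDiffAt_const
  unfold lapseE
  exact ((hΔ.mul (contDiffAt_sigmaE hy0)).div (contDiffAt_bigA hy0) (bigA_pos hM hy).ne').sqrt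
    (lapseSq_pos hM hy).ne'

end Smooth

/-! ### The normal in Kerr–Schild components -/

variable (M a b) in
/-- **The future unit normal of the Boyer–Lindquist leaf in the ingoing Kerr–Schild chart**:
`n(y) = α(y)⁻¹ (∂_{t*} + ω(y) J(L(y)))`, `J(x) = x₁∂₂ − x₂∂₁` the axial field at the leaf point.
Bardeen–Press–Teukolsky 1972, (2.5); Wald 1984, §10.2. [cite: BrandtSeidel1996, §II] -/
def normalRep (y : E3) : E4 :=
  (lapseE M a y)⁻¹ • (E4.basisVector 0 + omegaE M a y • E4.axialGenerator (leafRep M a b y))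

/-- `n⁰ = α⁻¹`. [cite: BrandtSeidel1996, §II] -/
theorem normalRep_apply_zero (y : E3) : normalRep M a b y 0 = (lapseE M a y)⁻¹ := by
  simp [normalRep]

/-- The normal is smooth beyond the threshold (`0 ≤ M`, base `b > rH`). [cite: BrandtSeidel1996, §II] -/
theorem contDiffAt_normalRep (hM : 0 ≤ M) (hb : rH M a < b) {y : E3} (hy : rhoH M a < ‖y‖) :
    ContDiffAt ℝ ∞ (normalRep M a b) y := by
  unfold normalRep
  exact ((contDiffAt_lapseE hM hy).inv (lapseE_pos hM hy).ne').smul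
    (contDiffAt_const.add ((contDiffAt_omegaE hM hy).smul
      (E4.axialGenerator.contDiff.contDiffAt.comp y (contDiffAt_leafRep hb hy))))

/-! ### Off the axis: the normal is the push-forward of the coordinate normal -/

/-- Components of `p⃗ = ∂_φ Y`. [cite: arXiv07060622, §4] -/
theorem jacP_apply_zero (a : ℝ) (u : E4) :
    jacP a u 0 = -(kerrStar a (u 1) (arccos (u 2)) (u 3) 1) := by
  simp [jacP, sin_arccos_eq]
  ring

/-- Components of `p⃗ = ∂_φ Y`. [cite: arXiv07060622, §4] -/
theorem jacP_apply_one (a : ℝ) (u : E4) :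
    jacP a u 1 = kerrStar a (u 1) (arccos (u 2)) (u 3) 0 := by
  simp [jacP, sin_arccos_eq]

/-- Components of `p⃗ = ∂_φ Y`. [cite: arXiv07060622, §4] -/
theorem jacP_apply_two (a : ℝ) (u : E4) : jacP a u 2 = 0 := by
  simp [jacP]

/-- **Off the axis the normal is the push-forward of the coordinate normal**:
`n(x) = J_{σ(x)} n_{σ(x)}` with `σ` the coordinate section about `x` (`‖x‖ > ρH`, `R > max r₀ 0`).
[cite: BrandtSeidel1996, §II] -/
theorem normalRep_eq {r₀ : ℝ} {x : E3} (hx : x 0 ≠ 0 ∨ x 1 ≠ 0)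
    (hR : max r₀ 0 < qiRadius M a ‖x‖) :
    normalRep M a b x = jac a (coordSection M a b x x) (blNormal M a (coordSection M a b x x)) := by
  have hmem : coordSection M a b x x ∈ coordDomain r₀ := coordSection_mem_coordDomain hx hR
  have hks : kerrStar a (coordSection M a b x x 1) (arccos (coordSection M a b x x 2))
      (coordSection M a b x x 3) = leafSpatial M a b x := by
    have h := congrArg E4.spatial
      (chartFun_coordSection (M := M) (a := a) (b := b) (r₀ := r₀) hx hx hR)
    rwa [chartFun_eq hmem, E4.spatial_ofTimeSpace, spatial_leafRep] at h
  have h1 : coordSection M a b x x 1 = qiRadius M a ‖x‖ := rfl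
  have h2 : coordSection M a b x x 2 = x 2 / ‖x‖ := rfl
  have hl : lapseE M a x = blLapse M a (coordSection M a b x x) := (blLapse_eq_lapseE h1 h2).symm
  have ho : omegaE M a x = blOmega M a (coordSection M a b x x) := (blOmega_eq_omegaE h1 h2).symm
  have o1 : ∀ (t : ℝ) (y : E3), E4.ofTimeSpace t y 1 = y 0 := fun _ _ ↦ rfl
  have o2 : ∀ (t : ℝ) (y : E3), E4.ofTimeSpace t y 2 = y 1 := fun _ _ ↦ rfl
  have o3 : ∀ (t : ℝ) (y : E3), E4.ofTimeSpace t y 3 = y 2 := fun _ _ ↦ rfl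
  have e0 : leafSpatial M a b x 0 = jacP a (coordSection M a b x x) 1 := by
    rw [jacP_apply_one, hks]
  have e1 : leafSpatial M a b x 1 = -jacP a (coordSection M a b x x) 0 := by
    rw [jacP_apply_zero, hks, neg_neg]
  ext i
  fin_cases i
  · simp [normalRep, jac_apply, blNormal, blNormal0, hl]
  · show normalRep M a b x 1 = jac a (coordSection M a b x x) (blNormal M a (coordSection M a b x x)) 1
    simp [normalRep, jac_apply, blNormal, blNormal0, hl, ho, leafRep, o1, o2, e1]
  · show normalRep M a b x 2 = jac a (coordSection M a b x x) (blNormal M a (coordSection M a b x x)) 2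
    simp [normalRep, jac_apply, blNormal, blNormal0, hl, ho, leafRep, o1, o2, e0]
  · show normalRep M a b x 3 = jac a (coordSection M a b x x) (blNormal M a (coordSection M a b x x)) 3
    simp [normalRep, jac_apply, blNormal, blNormal0, o3, jacP_apply_two]

/-- `Σ, A > 0` and `Δ ≠ 0` at the coordinate section point (for the coordinate identities).
[cite: BrandtSeidel1996, §II] -/
theorem coordSection_pos (hM : 0 ≤ M) {r₀ : ℝ} {x : E3} (hρ : rhoH M a < ‖x‖) (hx : x 0 ≠ 0 ∨ x 1 ≠ 0)
    (hR : max r₀ 0 < qiRadius M a ‖x‖) :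
    0 < Ingoing.delta M a (coordSection M a b x x 1) ∧ 0 < sigma a (coordSection M a b x x) ∧
      0 < blA M a (coordSection M a b x x) := by
  have hmem : coordSection M a b x x ∈ coordDomain r₀ := coordSection_mem_coordDomain hx hR
  have h1 : coordSection M a b x x 1 = qiRadius M a ‖x‖ := rfl
  have h2 : coordSection M a b x x 2 = x 2 / ‖x‖ := rfl
  refine ⟨delta_qiRadius_pos hρ, ?_, ?_⟩
  · rw [sigma_eq_sigmaE h1 h2]; exact sigmaE_pos hM hρ
  · rw [blA_eq_bigA h1 h2]; exact bigA_pos hM hρ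

/-- **Normality off the axis**: `g_{L(x)}(n(x), dL_x v) = 0` (`kerrBilin_jac` +
`bilin_blNormal_blLift`). Wald 1984, §10.2. [cite: BrandtSeidel1996, §II] -/
theorem bilin_normalRep_fderiv_leafRep (hM : 0 ≤ M) {r₀ : ℝ} {x : E3} (hb : rH M a < b)
    (hρ : rhoH M a < ‖x‖) (hx : x 0 ≠ 0 ∨ x 1 ≠ 0) (hR : max r₀ 0 < qiRadius M a ‖x‖) (v : E3) :
    Kerr.bilin M a (leafRep M a b x) (normalRep M a b x) (fderiv ℝ (leafRep M a b) x v) = 0 := by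
  have hmem : coordSection M a b x x ∈ coordDomain r₀ := coordSection_mem_coordDomain hx hR
  obtain ⟨hΔ, hS, hA⟩ := coordSection_pos (b := b) hM hρ hx hR
  rw [(hasFDerivAt_leafRep hb hρ hx hR).fderiv, normalRep_eq hx hR,
    ← chartFun_coordSection hx hx hR]
  simp only [ContinuousLinearMap.comp_apply]
  rw [kerrBilin_jac hmem, coordSectionDeriv_apply hx,
    show qiRadius M a ‖x‖ = coordSection M a b x x 1 from rfl]
  exact bilin_blNormal_blLift hΔ.ne' hS.ne' hA.ne' _ _ _

/-- **Unit timelike off the axis**: `g_{L(x)}(n(x), n(x)) = −1`. Wald 1984, §10.2.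
[cite: BrandtSeidel1996, §II] -/
theorem bilin_normalRep_self (hM : 0 ≤ M) {r₀ : ℝ} {x : E3} (hρ : rhoH M a < ‖x‖)
    (hx : x 0 ≠ 0 ∨ x 1 ≠ 0) (hR : max r₀ 0 < qiRadius M a ‖x‖) :
    Kerr.bilin M a (leafRep M a b x) (normalRep M a b x) (normalRep M a b x) = -1 := by
  have hmem : coordSection M a b x x ∈ coordDomain r₀ := coordSection_mem_coordDomain hx hR
  obtain ⟨hΔ, hS, hA⟩ := coordSection_pos (b := b) hM hρ hx hR
  rw [normalRep_eq hx hR, ← chartFun_coordSection hx hx hR, kerrBilin_jac hmem]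
  exact bilin_blNormal_self hΔ hS hA

/-! ### On the whole slice: continuity across the axis -/

/-- Continuity of `y ↦ g_{L(y)}(n(y), ·)` evaluated on continuous fields. [cite: BrandtSeidel1996, §II] -/
theorem continuousAt_bilin_normalRep (hM : 0 ≤ M) (hb : rH M a < b) {y : E3} (hy : rhoH M a < ‖y‖)
    {W : E3 → E4} (hW : ContinuousAt W y) :
    ContinuousAt (fun y ↦ Kerr.bilin M a (leafRep M a b y) (normalRep M a b y) (W y)) y := by
  have hy0 : y ≠ 0 := by
    intro h0; rw [h0, norm_zero] at hy; exact absurd hy (not_lt.2 (rhoH_nonneg M a))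
  have hL : ContinuousAt (leafRep M a b) y := (contDiffAt_leafRep hb hy).continuousAt
  have hN : ContinuousAt (normalRep M a b) y := (contDiffAt_normalRep hM hb hy).continuousAt
  have hrad : 0 < radius a (leafRep M a b y) := by
    rw [radius_leafRep M a b hy0 (qiRadius_pos_of_rhoH_lt hM hy)]
    exact qiRadius_pos_of_rhoH_lt hM hy
  have hB : ContinuousAt (fun y ↦ Kerr.bilin M a (leafRep M a b y)) y :=
    ((contDiffAt_bilin M a hrad (n := 0)).continuousAt).comp hL
  exact (hB.clm_apply hN).clm_apply hW

/-- **Normality on the whole slice** (axis included, by continuity). Wald 1984, §10.2.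
[cite: BrandtSeidel1996, §II] -/
theorem bilin_normalRep_fderiv_leafRep_of_mem (hM : 0 ≤ M) (hρ₁ : rhoH M a ≤ ρ₁) (hb : rH M a < b)
    (x : slice 0 ρ₁) (v : E3) :
    Kerr.bilin M a (leafRep M a b x) (normalRep M a b x) (fderiv ℝ (leafRep M a b) x v) = 0 := by
  set G : E3 → ℝ := fun y ↦
    Kerr.bilin M a (leafRep M a b y) (normalRep M a b y) (fderiv ℝ (leafRep M a b) y v) with hG
  have hcont : ContinuousOn G (slice 0 ρ₁) := by
    intro y hy
    have hyρ : rhoH M a < ‖y‖ := rhoH_lt_norm hρ₁ ⟨y, hy⟩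
    have hD : ContinuousAt (fun y ↦ fderiv ℝ (leafRep M a b) y) y :=
      ((contDiffAt_leafRep (M := M) (a := a) hb hyρ).fderiv_right (m := 0) (by norm_num)).continuousAt
    exact (continuousAt_bilin_normalRep hM hb hyρ (hD.clm_apply continuousAt_const)).continuousWithinAt
  have hoff : ∀ y ∈ slice 0 ρ₁, (y 0 ≠ 0 ∨ y 1 ≠ 0) → G y = 0 := by
    intro y hy hax
    exact bilin_normalRep_fderiv_leafRep hM hb (rhoH_lt_norm hρ₁ ⟨y, hy⟩) hax
      (max_lt_qiRadius hM hρ₁ ⟨y, hy⟩) v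
  exact eqOn_slice_of_offAxis hcont hoff x x.2

/-- **Unit timelike on the whole slice** (axis included, by continuity). Wald 1984, §10.2.
[cite: BrandtSeidel1996, §II] -/
theorem bilin_normalRep_self_of_mem (hM : 0 ≤ M) (hρ₁ : rhoH M a ≤ ρ₁) (hb : rH M a < b)
    (x : slice 0 ρ₁) :
    Kerr.bilin M a (leafRep M a b x) (normalRep M a b x) (normalRep M a b x) = -1 := by
  set G : E3 → ℝ := fun y ↦
    Kerr.bilin M a (leafRep M a b y) (normalRep M a b y) (normalRep M a b y) + 1 with hG
  have hcont : ContinuousOn G (slice 0 ρ₁) := by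
    intro y hy
    have hyρ : rhoH M a < ‖y‖ := rhoH_lt_norm hρ₁ ⟨y, hy⟩
    have hN : ContinuousAt (normalRep M a b) y := (contDiffAt_normalRep hM hb hyρ).continuousAt
    exact ((continuousAt_bilin_normalRep hM hb hyρ hN).add continuousAt_const).continuousWithinAt
  have hoff : ∀ y ∈ slice 0 ρ₁, (y 0 ≠ 0 ∨ y 1 ≠ 0) → G y = 0 := by
    intro y hy hax
    simp only [hG, bilin_normalRep_self hM (rhoH_lt_norm hρ₁ ⟨y, hy⟩) hax
      (max_lt_qiRadius hM hρ₁ ⟨y, hy⟩)]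
    ring
  have h := eqOn_slice_of_offAxis hcont hoff x x.2
  simp only [hG] at h
  linarith

/-! ### The future unit normal of the leaf -/

variable (M a b ρ₁) in
/-- **The normal field along the Boyer–Lindquist leaf.** [cite: BrandtSeidel1996, §II] -/
def normal (hM : 0 ≤ M) (hρ₁ : rhoH M a ≤ ρ₁) : NormalField 𝓘(ℝ, E4) (leaf M a b ρ₁ hM hρ₁) :=
  fun y ↦ normalRep M a b y

/-- Unfolding lemma. [cite: BrandtSeidel1996, §II] -/
@[simp] theorem normal_apply (hM : 0 ≤ M) (hρ₁ : rhoH M a ≤ ρ₁) (y : slice 0 ρ₁) :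
    normal M a b ρ₁ hM hρ₁ y = normalRep M a b y := rfl

/-- **`n` is the future unit normal of the Boyer–Lindquist leaf** for the Kerr time orientation
`−g♯dt*` (`0 ≤ M`, `ρ₁ ≥ ρH`, `b > rH`): normal, `g(n, n) = −1`, and future since
`g(−g♯dt*, n) = −n⁰ = −α⁻¹ < 0`. Wald 1984, §10.2; O'Neill 1983, Ch. 4, p. 106.
[cite: Wald1984, §10.2] -/
theorem isFutureUnitNormal_normal [Kerr.Facts] (hM : 0 ≤ M) (hρ₁ : rhoH M a ≤ ρ₁) (hb : rH M a < b) :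
    (Kerr.smoothMetric M a 0).IsFutureUnitNormal 𝓘(ℝ, E3) ((Kerr.timeOrientation M a 0 hM).ofLE le_top)
      (leaf M a b ρ₁ hM hρ₁) (normal M a b ρ₁ hM hρ₁) := by
  refine ⟨⟨fun y v ↦ ?_, fun y ↦ ?_⟩, fun y ↦ ⟨⟨?_, ?_⟩, ?_⟩⟩
  · set w : E3 := v with hw
    have hgoal : Kerr.bilin M a (leafRep M a b y) (normalRep M a b y)
        (fderiv ℝ (leafRep M a b) y w) = 0 :=
      bilin_normalRep_fderiv_leafRep_of_mem hM hρ₁ hb y w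
    rw [Kerr.smoothMetric_val, mfderiv_leaf_apply hM hρ₁ hb, coe_leaf]
    exact hgoal
  · have hgoal : Kerr.bilin M a (leafRep M a b y) (normalRep M a b y) (normalRep M a b y) = -1 :=
      bilin_normalRep_self_of_mem hM hρ₁ hb y
    rw [Kerr.smoothMetric_val, coe_leaf]
    exact hgoal
  · have hgoal : Kerr.bilin M a (leafRep M a b y) (normalRep M a b y) (normalRep M a b y) ≤ 0 := by
      rw [bilin_normalRep_self_of_mem hM hρ₁ hb y]; norm_num
    rw [Kerr.smoothMetric_val, coe_leaf]
    exact hgoal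
  · intro h0
    have h1 := congrArg (fun p : E4 ↦ p 0) h0
    have hpos : 0 < (lapseE M a (y : E3))⁻¹ := inv_pos.2 (lapseE_pos hM (rhoH_lt_norm hρ₁ y))
    simp only [normal_apply, normalRep_apply_zero] at h1
    rw [h1] at hpos
    exact lt_irrefl _ hpos
  · have hrad : 0 < radius a (leafRep M a b y) := by
      rw [radius_leafRep M a b (ne_zero_of_mem_slice_zero y)
        (qiRadius_pos_of_rhoH_lt hM (rhoH_lt_norm hρ₁ y))]
      exact qiRadius_pos_of_rhoH_lt hM (rhoH_lt_norm hρ₁ y)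
    have hgoal : Kerr.bilin M a (leafRep M a b y) (Kerr.timeVector M a (leafRep M a b y))
        (normalRep M a b y) < 0 := by
      rw [Kerr.bilin_timeVector hrad, normalRep_apply_zero, neg_lt_zero]
      exact inv_pos.2 (lapseE_pos hM (rhoH_lt_norm hρ₁ y))
    rw [TimeOrientation.vectorField_ofLE, Kerr.smoothMetric_val, coe_leaf]
    exact hgoal

end Kerr.BL

end Literature.Geometry.Lorentzian

end
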